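import Literature.NumberTheory.EllipticCurves.ModularParamIntegralityProofs
import HarnessLib

/-!
# A pointwise RATIONAL presentation of `x = ℘_Λ(2πi∫f)` (line `nsf` v21, stub S3-X `stub_x1Denominator`, part X-a; crux `StarOptBNSF`, stmt-BirchSwinnertonDyer-27047)

Let `f ∈ S₂(Γ₀(N))` be nonzero with rational Fourier coefficients and `Λ = Λ(L) ⊇ Λ_f` a lattice with `g₂(L), g₃(L) ∈ ℚ`.
The tree knows (i) a POINTWISE presentation `℘_Λ(u(τ))·G₀(τ) = F₀(τ)` off the poles by (irrational, level-one-built) cusp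
forms (`exists_isXPresentation`), and (ii) a RATIONAL presentation at the level of `q`-expansions, `x·q-exp(G₁) = q-exp(F₁)` with
`D·aₘ(G₁) ∈ ℤ` (`IsXPresentation.exists_rat_presentation`, Galois descent + Shimura 3.52).  Here we make (ii) pointwise:
**there are `k ≥ 12`, cusp forms `F, G ∈ S_k(Γ₀(N))` and `D ≥ 1` with `IsXPresentation f L F G` (so `G ≠ 0` and
`℘_Λ(u(τ))G(τ) = F(τ)` whenever `u(τ) ∉ Λ`) and `D·aₘ(G) ∈ ℤ` for all `m`** (`exists_rat_isXPresentation`).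
Proof: cross-multiplying the two Laurent identities gives `q-exp(F₀)·q-exp(G₁) = q-exp(G₀)·q-exp(F₁)`, i.e. the cusp forms
`F₀G₁` and `G₀F₁` of weight `2k` have the same `q`-expansion, hence are equal (`q`-expansion principle on `Γ₀(N)`); so
`G₀·(℘_Λ(u)G₁ − F₁) = 0` near every regular point, and since `G₀ ≢ 0` on the connected half-plane the analytic factor
`℘_Λ(u)G₁ − F₁` vanishes on a ball around the point (isolated zeros).
No number theory beyond the cited tree theorems; nothing here reads `r_an`; BSD is not proved by this file.
-/

set_option linter.dupNamespace false
set_option autoImplicit false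

noncomputable section

open Complex Filter Topology Set Function PowerSeries
open UpperHalfPlane hiding I
open scoped Real Topology Manifold MatrixGroups PeriodPair ModularForm
open ModularForm CongruenceSubgroup

open Literature.NumberTheory.EllipticCurves Literature.NumberTheory.EllipticCurves.ModularForms

namespace Summit.BirchSwinnertonDyer.BirchSwinnertonDyer.Theorems.DepletionAtTwo.X1RatPres

variable {N : ℕ} [NeZero N] {k : ℤ}

/-- Products of cusp forms with equal `q`-expansions of the factors' products are equal pointwise:
if `q-exp(F₀)·q-exp(G₁) = q-exp(G₀)·q-exp(F₁)` then `F₀(τ)G₁(τ) = G₀(τ)F₁(τ)` (`q`-expansion principle on `Γ₀(N)`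
applied to `F₀·G₁` and `G₀·F₁`). [folklore] -/
theorem apply_mul_eq_of_qExpansion_mul_eq {F₀ G₀ F₁ G₁ : CuspForm (Gamma0 N) k}
    (h : qExpansion 1 (⇑F₀) * qExpansion 1 (⇑G₁) = qExpansion 1 (⇑G₀) * qExpansion 1 (⇑F₁)) (τ : ℍ) :
    F₀ τ * G₁ τ = G₀ τ * F₁ τ := by
  have h1 : qExpansion 1 (⇑(F₀.mulModularForm (G₁ : ModularForm (Gamma0 N) k))) =
      qExpansion 1 (⇑(G₀.mulModularForm (F₁ : ModularForm (Gamma0 N) k))) := by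
    rw [qExpansion_mulModularForm, qExpansion_mulModularForm]
    exact h
  have h2 : F₀.mulModularForm (G₁ : ModularForm (Gamma0 N) k) = G₀.mulModularForm (F₁ : ModularForm (Gamma0 N) k) := by
    refine eq_of_forall_cuspCoeff_eq_gamma0 fun n ↦ ?_
    simp only [cuspCoeff, h1]
  have h3 := DFunLike.congr_fun h2 τ
  simpa [CuspForm.coe_mulModularForm] using h3

/-- **A pointwise rational presentation of `x = ℘_Λ(2πi∫f)`.**  For `f ≠ 0` with rational coefficients and `Λ(L) ⊇ Λ_f` with
`g₂(L), g₃(L) ∈ ℚ`: there are `k ≥ 12`, `F, G ∈ S_k(Γ₀(N))` with `IsXPresentation f L F G` and `D ≥ 1` with `D·aₘ(G) ∈ ℤ`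
for all `m`. [cite: ShimuraIATAF1971, Thm. 3.52 and Thm. 7.14] -/
theorem exists_rat_isXPresentation (f : CuspForm (Gamma0 N) 2) (hf : f ≠ 0)
    (hrat : ∀ n, ∃ q : ℚ, (q : ℂ) = cuspCoeff f n) (L : PeriodPair)
    (hΛ : ∀ x ∈ periodLattice f, x ∈ L.lattice)
    (hg₂ : ∃ q : ℚ, (q : ℂ) = L.g₂) (hg₃ : ∃ q : ℚ, (q : ℂ) = L.g₃) :
    ∃ (k : ℤ) (F G : CuspForm (Gamma0 N) k) (D : ℕ), 12 ≤ k ∧ IsXPresentation f L F G ∧ 0 < D ∧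
      ∀ m, ∃ z : ℤ, (D : ℂ) * cuspCoeff G m = z := by
  obtain ⟨k, F₀, G₀, hk, h⟩ := exists_isXPresentation f hf L hΛ
  obtain ⟨F₁, G₁, D₁, D₂, hG₁0, hD₁, -, hLaur, hD₁int, -⟩ :=
    h.exists_rat_presentation hf (by omega) hrat hg₂ hg₃
  refine ⟨k, F₁, G₁, D₁, hk, ⟨hG₁0, fun τ hτ ↦ ?_⟩, hD₁, hD₁int⟩
  -- the two Laurent identities give `q-exp(F₀)·q-exp(G₁) = q-exp(G₀)·q-exp(F₁)`
  have hx := h.coe_xFn_mul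
  have hPS : qExpansion 1 (⇑F₀) * qExpansion 1 (⇑G₁) = qExpansion 1 (⇑G₀) * qExpansion 1 (⇑F₁) := by
    apply HahnSeries.ofPowerSeries_injective (Γ := ℤ) (R := ℂ)
    change (((qExpansion 1 (⇑F₀) * qExpansion 1 (⇑G₁) : ℂ⟦X⟧) : LaurentSeries ℂ)) =
      (((qExpansion 1 (⇑G₀) * qExpansion 1 (⇑F₁) : ℂ⟦X⟧) : LaurentSeries ℂ))
    rw [PowerSeries.coe_mul, PowerSeries.coe_mul, ← hx, ← hLaur]
    ring
  have hpt : ∀ σ : ℍ, F₀ σ * G₁ σ = G₀ σ * F₁ σ := apply_mul_eq_of_qExpansion_mul_eq hPS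
  -- near `τ`: `G₀·(℘(u)G₁ − F₁) = 0`, and `G₀ ≢ 0`
  set z : ℂ := (τ : ℂ) with hz
  have hzim : 0 < z.im := τ.im_pos
  have hzL : eichlerIntegral f (ofComplex z) ∉ L.lattice := by rwa [hz, ofComplex_apply]
  set A : ℂ → ℂ := fun w ↦ ℘[L] (eichlerIntegral f (ofComplex w)) * G₁ (ofComplex w) - F₁ (ofComplex w)
    with hA
  set Gc : ℂ → ℂ := (⇑G₀) ∘ ofComplex with hGc
  have hopen : IsOpen {w : ℂ | 0 < w.im ∧ eichlerIntegral f (ofComplex w) ∉ L.lattice} :=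
    isOpen_setOf_eichlerIntegral_notMem_lattice f L
  obtain ⟨ε, hε, hball⟩ := Metric.isOpen_iff.mp hopen z ⟨hzim, hzL⟩
  have hGan : AnalyticOnNhd ℂ Gc {w : ℂ | 0 < w.im} :=
    (UpperHalfPlane.mdifferentiable_iff.mp G₀.holo').analyticOnNhd isOpen_upperHalfPlaneSet
  have hG₁an : AnalyticOnNhd ℂ ((⇑G₁) ∘ ofComplex) {w : ℂ | 0 < w.im} :=
    (UpperHalfPlane.mdifferentiable_iff.mp G₁.holo').analyticOnNhd isOpen_upperHalfPlaneSet
  have hF₁an : AnalyticOnNhd ℂ ((⇑F₁) ∘ ofComplex) {w : ℂ | 0 < w.im} :=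
    (UpperHalfPlane.mdifferentiable_iff.mp F₁.holo').analyticOnNhd isOpen_upperHalfPlaneSet
  have hAan : AnalyticOnNhd ℂ A (Metric.ball z ε) := fun w hw ↦ by
    have hw' := hball hw
    exact ((analyticOnNhd_weierstrassP_eichlerIntegral f L w hw').mul (hG₁an w hw'.1)).sub (hF₁an w hw'.1)
  have hGan' : AnalyticOnNhd ℂ Gc (Metric.ball z ε) := fun w hw ↦ hGan w (hball hw).1
  have hprod : ∀ w ∈ Metric.ball z ε, Gc w * A w = 0 := by
    intro w hw
    have hw' := hball hw
    have h1 := h.2 (ofComplex w) hw'.2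
    have h2 := hpt (ofComplex w)
    simp only [hGc, hA, comp_apply]
    linear_combination G₁ (ofComplex w) * h1 + h2
  rcases AnalyticOnNhd.eq_zero_or_eq_zero_of_mul_eq_zero hGan' hAan hprod
    (convex_ball z ε).isPreconnected with h0 | h0
  · -- `G₀ ≡ 0` on a ball ⇒ `G₀ = 0` on the half-plane: excluded
    exfalso
    apply h.1
    have hev : Gc =ᶠ[𝓝 z] 0 := by
      filter_upwards [Metric.ball_mem_nhds z hε] with w hw
      exact h0 w hw
    have heq := hGan.eqOn_zero_of_preconnected_of_eventuallyEq_zero convex_setOf_im_pos.isPreconnected hzim hev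
    apply DFunLike.ext
    intro σ
    have := heq σ.im_pos
    simpa [hGc, ofComplex_apply] using this
  · have := h0 z (Metric.mem_ball_self hε)
    simp only [hA, hz, ofComplex_apply] at this
    exact sub_eq_zero.mp this

end Summit.BirchSwinnertonDyer.BirchSwinnertonDyer.Theorems.DepletionAtTwo.X1RatPres

end
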